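import Literature.Probability.RandomPlanarGeometry.SLEKappaRhoSchemeDriver
import Literature.Probability.RandomPlanarGeometry.SLEKappaRhoRegular
import Literature.Analysis.FunctionSpaces.BesselBoundaryZeroSetProofs
import HarnessLib

/-!
# [LSW] §8.3–8.4: the SLE(8/3, ρ) pair read through the scheme driver (bridge lemmas)

G. F. Lawler, O. Schramm, W. Werner, *Conformal restriction: the chordal case*, J. Amer. Math.
Soc. **16** (2003) 917–955 (**[LSW]**), §8.3 (definition of SLE(κ, ρ): `W = Z + O`,
`O_t = −2 ∫₀ᵗ du/Z_u`, "`∫₀ᵗ du/Z_u = (Z_t − √κ B_t)/(ρ + 2) < ∞`", `Z = √κ X` for a Bessel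
process `X` of dimension `d = 1 + 2(ρ + 2)/κ`) and §8.4 (Lemma 8.9).

The conditional-increment proof of Lemma 8.9 (`SLEKappaRhoCellMartingale`,
`SLEKappaRhoSchemeDriver`, `SLEKappaRhoSchemeProcesses`) runs along the everywhere-continuous
adapted driver `drvC J ρ c = √(8/3) B + ρ · clockTrunc J c` of a progressive integrand `J`, with
the relative force point `oposC J ρ c = min (−(drvC + 2 clockTrunc)) 0`. This file supplies the
integrand for an actual SLE(8/3, ρ) pair `(O, W)` and the almost-sure dictionary between the two
descriptions (the hypotheses `ae_W`, `ae_clock` of `SLEKappaRho.CellScheme` and the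
identifications consumed by `SLEKappaRho.IsLocalisingFamily.isMartingaleExtension`):

* `IsSLEKappaRhoPair.exists_regularPair_fst` — **a regular version `(W', J)` of `W`
  (`SLEKappaRho.RegularPair`, `SLEKappaRhoRegular`) which moreover records the force point:
  a.s. `O_t = −2 ∫₀ᵗ J` for all `t`** (same construction as
  `IsSLEKappaRhoPair.exists_regularPair`: `J = 1/(√κ √Z⁰)` for the progressive modification `Z⁰`
  of the squared Bessel process of the pair);
* `IsSLEKappaRhoPair.ae_volume_zeroSet_eq_zero` — **a.s. the zero set `{t > 0 : W_t − O_t = 0}`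
  of `Z = √κ X` is Lebesgue-null** (`X` is a Bessel process of dimension `d > 1`; Revuz–Yor
  Ch. XI Prop. (1.5), the tree's `IsBesselProcess.ae_pos_of_ae_restrict_Ioi_holds`);
* for a regular version `(W', J)` of an SLE(8/3, ρ) driving process `W` with the force-point
  clause: a.s. the clock `clock J` is finite and equals `∫₀ J` (`RegularPair.ae_clock_eq`); a.s.,
  for all `c, t` with `clock J t ≤ c`: `clockTrunc J c t = ∫₀ᵗ J`, `drvC J ρ c t = W_t = W'_t`
  (`RegularPair.ae_drvC_eq`), `oposC J ρ c t = O_t − W_t` (`RegularPair.ae_oposC_eq`),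
  `(drvC + 2 clockTrunc) · J = 𝟙{drvC + 2 clockTrunc ≠ 0}` (`RegularPair.ae_mul_J_eq_ite`), the
  driving PATH `drvPath J ρ c ω` agrees with `W(ω)` on `[0, t]` (`RegularPair.ae_drvPath_eq`), hence
  the closed hulls, alive events and slid hulls at time `t` agree
  (`RegularPair.ae_hulls_drvPath_eq`).

No named facts, no new definitions.

## References

* [LSW] §8.3 (definition of SLE(κ, ρ), p. 36), §8.4 (Lemma 8.9). [LawlerSchrammWerner2003Restriction]
* D. Revuz, M. Yor, *Continuous Martingales and Brownian Motion* (1999), Ch. XI Prop. (1.5).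
  [RevuzYor1999]
-/

noncomputable section

open Set Filter Topology MeasureTheory
open scoped NNReal ENNReal
open Literature.Analysis.FunctionSpaces Literature.Probability.Process

namespace Literature.Probability.RandomPlanarGeometry

/-! ### A regular version recording the force point -/

/-- **Every SLE(κ, ρ) driving pair (`κ > 0`, `ρ > −2`) has a regular version `(W', J)` with
`O_t = −2 ∫₀ᵗ J_s ds` almost surely for all `t`** (the construction of
`IsSLEKappaRhoPair.exists_regularPair`: with the progressive modification `Z⁰ = dyadicReg Z` of the
squared Bessel process `Z` of the pair, `J = (√κ √Z⁰)⁻¹` and `W' = √κ √Z⁰ − 2 ∫₀ J`; on the a.s.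
event `Z⁰ = Z`, `J_u = 1/Z_u` and `−2 ∫₀ᵗ J = −2 ∫₀ᵗ du/Z_u = O_t` literally).
[cite: LawlerSchrammWerner2003Restriction, §8.3 (definition of SLE(κ, ρ), p. 36)] -/
theorem IsSLEKappaRhoPair.exists_regularPair_fst {κ : ℝ≥0} {ρ : ℝ} {O W : ℝ≥0 → (ℝ≥0 → ℝ) → ℝ}
    (hκ : 0 < κ) (hρ : -2 < ρ) (hOW : IsSLEKappaRhoPair κ ρ O W) :
    ∃ W' J, SLEKappaRho.RegularPair κ ρ W W' J ∧
      ∀ᵐ ω ∂preWienerMeasure, ∀ t, O t ω = -2 * timeIntegral J t ω := by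
  obtain ⟨X, ⟨Z, hZ, hXZ⟩, hO, hW⟩ := id hOW
  obtain ⟨-, hprog, hae⟩ := IsStrongSolution.dyadicReg_spec hZ
  set Zr := dyadicReg Z with hZr
  set J : ℝ≥0 → (ℝ≥0 → ℝ) → ℝ := fun s ω ↦ (Real.sqrt κ * Real.sqrt (Zr s ω))⁻¹ with hJ
  set W' : ℝ≥0 → (ℝ≥0 → ℝ) → ℝ :=
    fun t ω ↦ Real.sqrt κ * Real.sqrt (Zr t ω) + (-2) * timeIntegral J t ω with hW'
  have hJprog : IsStronglyProgressive brownianFiltration J := by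
    have hF : Measurable (Function.uncurry fun (_ : ℝ) (v : ℝ) ↦ (Real.sqrt κ * Real.sqrt v)⁻¹) :=
      (measurable_const.mul measurable_snd.sqrt).inv
    exact IsStronglyProgressive.comp_measurable₂ hprog (F := fun _ v ↦ (Real.sqrt κ * Real.sqrt v)⁻¹) hF
  have hZad : Adapted brownianFiltration Zr := adapted_dyadicReg hZ.adapted
  -- on the a.s. event `Zr = Z`: the integrand and the driving function are those of the pair
  have hJeq : ∀ ω, (∀ t, Zr t ω = Z t ω) → ∀ u : ℝ,
      J u.toNNReal ω = (W u.toNNReal ω - O u.toNNReal ω)⁻¹ := by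
    intro ω hω u
    simp only [hJ, hω, hW u.toNNReal ω, hXZ u.toNNReal ω, add_sub_cancel_right]
  have hJeqX : ∀ ω, (∀ t, Zr t ω = Z t ω) → ∀ u : ℝ,
      J u.toNNReal ω = (Real.sqrt κ * X u.toNNReal ω)⁻¹ := by
    intro ω hω u
    simp only [hJ, hω, hXZ u.toNNReal ω]
  have hIeq : ∀ ω, (∀ t, Zr t ω = Z t ω) → ∀ t : ℝ≥0,
      timeIntegral J t ω = ∫ u in (0 : ℝ)..(t : ℝ), (Real.sqrt κ * X u.toNNReal ω)⁻¹ := by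
    intro ω hω t
    simp only [timeIntegral]
    exact intervalIntegral.integral_congr fun u _ ↦ hJeqX ω hω u
  have hW'eq : ∀ ω, (∀ t, Zr t ω = Z t ω) → ∀ t, W' t ω = W t ω := by
    intro ω hω t
    rw [hW t ω, hXZ t ω, hO t ω]
    simp only [hW', hω, hIeq ω hω t]
  refine ⟨W', J, ⟨?_, ?_, hJprog, ?_, ?_, ?_, ?_, ?_, ?_⟩, ?_⟩
  · -- adapted
    intro t
    exact (((hZad t).sqrt).const_mul _).add ((adapted_timeIntegral hJprog t).const_mul _)
  · -- `W'_0 = 0`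
    intro ω
    have h0 : Zr 0 ω = 0 := by
      rw [hZr, dyadicReg_apply_zero, IsStrongSolution.apply_zero hZ]
      simp
    simp [hW', h0, timeIntegral_apply_zero]
  · -- `J ≥ 0`
    intro t ω
    exact inv_nonneg.2 (mul_nonneg (Real.sqrt_nonneg _) (Real.sqrt_nonneg _))
  · -- `J = 1/Z'`
    intro t ω
    simp only [hW', hJ]
    ring_nf
  · -- a.s. `W' = W`
    filter_upwards [hae] with ω hω t using hW'eq ω hω t
  · -- a.s. continuity
    filter_upwards [hae, hOW.ae_continuous SLEKappaRho.integral_inv_eq_holds hκ hρ] with ω hω hc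
    have : (fun t ↦ W' t ω) = fun t ↦ W t ω := funext (hW'eq ω hω)
    rw [this]
    exact hc.1
  · -- a.s. integrability of `J`
    filter_upwards [hae, SLEKappaRho.integral_inv_eq_holds hκ hρ hOW] with ω hω hint t
    have : (fun s : ℝ ↦ J s.toNNReal ω) = fun s ↦ (W s.toNNReal ω - O s.toNNReal ω)⁻¹ :=
      funext (hJeq ω hω)
    rw [this]
    exact (hint t).1
  · -- a.s. `W' = √κ B + ρ ∫ J`
    filter_upwards [hae, SLEKappaRho.ae_snd_eq_of SLEKappaRho.integral_inv_eq_holds hκ hρ hOW]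
      with ω hω hB t
    have hI : timeIntegral J t ω = ∫ u in (0 : ℝ)..(t : ℝ), (W u.toNNReal ω - O u.toNNReal ω)⁻¹ := by
      simp only [timeIntegral]
      exact intervalIntegral.integral_congr fun u _ ↦ hJeq ω hω u
    rw [hW'eq ω hω t, hI]
    exact hB t
  · -- a.s. `O = -2 ∫ J`
    filter_upwards [hae] with ω hω t
    rw [hO t ω, hIeq ω hω t]

/-- **The zero set of `Z = W − O` is a.s. Lebesgue-null**: for an SLE(κ, ρ) pair (`κ > 0`,
`ρ > −2`), almost surely `Leb{r > 0 : W_r − O_r = 0} = 0` (`W − O = √κ X` with `X` a Bessel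
process of dimension `1 + 2(ρ + 2)/κ > 1`, whose zero set is Lebesgue-null, Revuz–Yor Ch. XI
Prop. (1.5), `IsBesselProcess.ae_pos_of_ae_restrict_Ioi_holds`).
[cite: RevuzYor1999, Ch. XI Prop. (1.5)] -/
theorem IsSLEKappaRhoPair.ae_volume_zeroSet_eq_zero {κ : ℝ≥0} {ρ : ℝ} {O W : ℝ≥0 → (ℝ≥0 → ℝ) → ℝ}
    (hκ : 0 < κ) (hρ : -2 < ρ) (hOW : IsSLEKappaRhoPair κ ρ O W) :
    ∀ᵐ ω ∂preWienerMeasure, volume {r : ℝ | 0 < r ∧ W r.toNNReal ω - O r.toNNReal ω = 0} = 0 := by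
  obtain ⟨X, hX, hO, hW⟩ := hOW
  have hκ' : (0 : ℝ) < κ := by exact_mod_cast hκ
  have hδ : 1 < sleKappaRhoDim κ ρ := by
    unfold sleKappaRhoDim
    have : 0 < 2 * (ρ + 2) / (κ : ℝ) := by
      apply div_pos _ hκ'
      linarith
    linarith
  filter_upwards [IsBesselProcess.ae_pos_of_ae_restrict_Ioi_holds hδ le_rfl hX] with ω hω
  rw [ae_restrict_iff' measurableSet_Ioi] at hω
  refine measure_mono_null (fun r hr ↦ ?_) (ae_iff.1 hω)
  obtain ⟨hr0, hz⟩ := hr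
  simp only [mem_setOf_eq]
  intro himp
  have hX0 : X r.toNNReal ω = 0 := by
    rw [hW r.toNNReal ω, add_sub_cancel_right] at hz
    rcases mul_eq_zero.1 hz with h | h
    · exact absurd h (Real.sqrt_pos.2 hκ').ne'
    · exact h
  exact (himp hr0).ne' hX0

namespace SLEKappaRho

namespace RegularPair

variable {κ : ℝ≥0} {ρ : ℝ} {O W W' J : ℝ≥0 → (ℝ≥0 → ℝ) → ℝ}

/-- `Z' · J = 𝟙{Z' ≠ 0}` pointwise, `Z' = W' + 2 ∫₀ J` (`J` is the inverse of `Z'`, with `0⁻¹ = 0`).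
[folklore] -/
theorem mul_J_eq_ite (h : RegularPair κ ρ W W' J) (t : ℝ≥0) (ω : ℝ≥0 → ℝ) :
    (W' t ω + 2 * timeIntegral J t ω) * J t ω =
      if W' t ω + 2 * timeIntegral J t ω = 0 then 0 else 1 := by
  rw [h.eq_inv t ω]
  split_ifs with hz
  · rw [hz]; simp
  · exact mul_inv_cancel₀ hz

/-- A.s. the path `s ↦ J_s` is integrable on every `(0, t]`. [folklore] -/
theorem ae_integrableOn (h : RegularPair κ ρ W W' J) :
    ∀ᵐ ω ∂preWienerMeasure, ∀ t : ℝ≥0, IntegrableOn (fun s : ℝ ↦ J s.toNNReal ω) (Ioc (0 : ℝ) t) := by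
  filter_upwards [h.ae_intervalIntegrable] with ω hint t
  exact (intervalIntegrable_iff_integrableOn_Ioc_of_le t.coe_nonneg).1 (hint t)

/-- **A.s. the clock of `J` is finite and is `∫₀ J`**: `clock J t = ofReal (∫₀ᵗ J)` for all `t`.
[cite: LawlerSchrammWerner2003Restriction, §8.3 ("∫₀ᵗ du/Z_u < ∞")] -/
theorem ae_clock_eq (h : RegularPair κ ρ W W' J) :
    ∀ᵐ ω ∂preWienerMeasure, ∀ t : ℝ≥0, clock J t ω = ENNReal.ofReal (timeIntegral J t ω) := by
  filter_upwards [h.ae_integrableOn] with ω hint t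
  exact (toReal_clock_eq_timeIntegral (fun s ↦ h.nonneg s ω) hint t).1

/-- A.s., for every level `c` there is a time `t` with `clock J t ≤ c`… rather: **every time is
eventually below the truncation level**: a.s., for all `t`, `clock J t ≤ c` for all `c ≥ ∫₀ᵗ J`.
[folklore] -/
theorem ae_clock_le_of_le (h : RegularPair κ ρ W W' J) :
    ∀ᵐ ω ∂preWienerMeasure, ∀ (t c : ℝ≥0), timeIntegral J t ω ≤ c → clock J t ω ≤ (c : ℝ≥0∞) := by
  filter_upwards [h.ae_clock_eq] with ω hω t c hc
  rw [hω t, ← ENNReal.ofReal_coe_nnreal]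
  exact ENNReal.ofReal_le_ofReal hc

/-- **The scheme driver is the driving process while the clock is below the level** (`κ = 8/3`):
a.s., for all `c, t` with `clock J t ≤ c`, `clockTrunc J c t = ∫₀ᵗ J`, `drvC J ρ c t = W_t` and
`drvC J ρ c t = W'_t`. [cite: LawlerSchrammWerner2003Restriction, §8.3 (W_t = √κ B_t + ρ ∫₀ᵗ du/Z_u)] -/
theorem ae_drvC_eq (h : RegularPair (8 / 3) ρ W W' J) :
    ∀ᵐ ω ∂preWienerMeasure, ∀ (c t : ℝ≥0), clock J t ω ≤ (c : ℝ≥0∞) →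
      clockTrunc J c t ω = timeIntegral J t ω ∧ drvC J ρ c t ω = W t ω ∧ drvC J ρ c t ω = W' t ω := by
  filter_upwards [h.ae_integrableOn, h.ae_eq, h.ae_eq_brownian] with ω hint heq hB c t hc
  have h1 : clockTrunc J c t ω = timeIntegral J t ω := by
    rw [clockTrunc_eq_toReal hc]
    exact (toReal_clock_eq_timeIntegral (fun s ↦ h.nonneg s ω) hint t).2
  have h83 : ((8 / 3 : ℝ≥0) : ℝ) = 8 / 3 := by norm_num
  have h2 : drvC J ρ c t ω = W' t ω := by
    rw [drvC, h1, hB t, h83]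
  exact ⟨h1, h2.trans (heq t), h2⟩

/-- **The scheme driving path agrees with the path of `W` on `[0, t]` while the clock is below the
level.** [folklore] -/
theorem ae_drvPath_eq (h : RegularPair (8 / 3) ρ W W' J) :
    ∀ᵐ ω ∂preWienerMeasure, ∀ (c t : ℝ≥0), clock J t ω ≤ (c : ℝ≥0∞) →
      ∀ s, s ≤ t → drvPath J ρ c ω s = W s ω := by
  filter_upwards [h.ae_drvC_eq] with ω hω c t hc s hs
  exact (hω c s ((monotone_clock J ω hs).trans hc)).2.1

/-- `(drvC + 2 clockTrunc) · J = 𝟙{drvC + 2 clockTrunc ≠ 0}` a.s. while the clock is below the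
level (the clause `ae_clock` of `SLEKappaRho.CellScheme`). [folklore] -/
theorem ae_mul_J_eq_ite (h : RegularPair (8 / 3) ρ W W' J) :
    ∀ᵐ ω ∂preWienerMeasure, ∀ (c t : ℝ≥0), clock J t ω ≤ (c : ℝ≥0∞) →
      (drvC J ρ c t ω + 2 * clockTrunc J c t ω) * J t ω =
        if drvC J ρ c t ω + 2 * clockTrunc J c t ω = 0 then 0 else 1 := by
  filter_upwards [h.ae_drvC_eq] with ω hω c t hc
  obtain ⟨hI, -, hW'⟩ := hω c t hc
  rw [hI, hW']
  exact h.mul_J_eq_ite t ω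

/-- **The relative force point**: with the force-point clause `O = −2 ∫₀ J` a.s., for all `c, t`
with `clock J t ≤ c`, `oposC J ρ c t = O_t − W_t` and `drvC + 2 clockTrunc = W_t − O_t` (`= Z_t ≥ 0`).
[cite: LawlerSchrammWerner2003Restriction, §8.3 (O_t ≤ W_t)] -/
theorem ae_oposC_eq (h : RegularPair (8 / 3) ρ W W' J)
    (hO : ∀ᵐ ω ∂preWienerMeasure, ∀ t, O t ω = -2 * timeIntegral J t ω) :
    ∀ᵐ ω ∂preWienerMeasure, ∀ (c t : ℝ≥0), clock J t ω ≤ (c : ℝ≥0∞) →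
      oposC J ρ c t ω = O t ω - W t ω ∧ drvC J ρ c t ω + 2 * clockTrunc J c t ω = W t ω - O t ω := by
  filter_upwards [h.ae_drvC_eq, hO, h.ae_eq] with ω hω hO heq c t hc
  obtain ⟨hI, hWt, hW'⟩ := hω c t hc
  have hZ : 0 ≤ W' t ω + 2 * timeIntegral J t ω := h.add_nonneg' t ω
  have h2 : drvC J ρ c t ω + 2 * clockTrunc J c t ω = W t ω - O t ω := by
    rw [hI, hWt, hO t]; ring
  refine ⟨?_, h2⟩
  rw [oposC, h2, min_eq_left]
  · ring
  · rw [hO t, ← heq t]; linarith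

/-- **The zero set of the scheme's `Z = drvC + 2 clockTrunc` is a.s. Lebesgue-null up to any time at
which the clock is below the level** (the clause `ae_clock` of `SLEKappaRho.CellScheme`), for a
regular version with the force-point clause of an SLE(8/3, ρ) pair, `ρ > −2`.
[cite: RevuzYor1999, Ch. XI Prop. (1.5)] -/
theorem ae_volume_zeroSet_eq_zero (h : RegularPair (8 / 3) ρ W W' J) (hρ : -2 < ρ)
    (hOW : IsSLEKappaRhoPair (8 / 3) ρ O W)
    (hO : ∀ᵐ ω ∂preWienerMeasure, ∀ t, O t ω = -2 * timeIntegral J t ω) :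
    ∀ᵐ ω ∂preWienerMeasure, ∀ (c t : ℝ≥0), clock J t ω ≤ (c : ℝ≥0∞) →
      volume {r : ℝ | 0 < r ∧ r ≤ t ∧ drvC J ρ c r.toNNReal ω + 2 * clockTrunc J c r.toNNReal ω = 0} = 0 := by
  have h83 : (0 : ℝ≥0) < 8 / 3 := by norm_num
  filter_upwards [h.ae_oposC_eq hO, hOW.ae_volume_zeroSet_eq_zero h83 hρ] with ω hω hzero c t hc
  refine measure_mono_null (fun r hr ↦ ?_) hzero
  obtain ⟨hr0, hrt, hz⟩ := hr
  refine ⟨hr0, ?_⟩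
  have hrt' : r.toNNReal ≤ t := by
    rw [← Real.toNNReal_coe (r := t)]
    exact Real.toNNReal_le_toNNReal hrt
  rw [(hω c r.toNNReal ((monotone_clock J ω hrt').trans hc)).2] at hz
  exact hz

/-- **The hulls along the scheme driver are those of `W` while the clock is below the level**:
a.s., for all `c, t` with `clock J t ≤ c`, the closed hulls at time `t` agree (so do the alive
events for any `A`), and at an alive time the slid hulls of a `*`-hull `A` agree. [folklore] -/
theorem ae_hulls_drvPath_eq (h : RegularPair (8 / 3) ρ W W' J) {A : Set ℂ} (hA : IsStarHull A) :
    ∀ᵐ ω ∂preWienerMeasure, ∀ (c t : ℝ≥0), clock J t ω ≤ (c : ℝ≥0∞) →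
      Loewner.closedHull (drvPath J ρ c ω) t = Loewner.closedHull (fun s ↦ W s ω) t ∧
      (Disjoint (Loewner.closedHull (fun s ↦ W s ω) t) A →
        Loewner.slidHull (drvPath J ρ c ω) A t = Loewner.slidHull (fun s ↦ W s ω) A t) := by
  filter_upwards [h.ae_drvPath_eq, h.ae_continuous, h.ae_eq] with ω hω hc heq c t hct
  have hWc : Continuous fun s ↦ W s ω := by
    have : (fun s ↦ W s ω) = fun s ↦ W' s ω := funext fun s ↦ (heq s).symm
    rw [this]; exact hc
  have hpath : ∀ s, s ≤ t → (fun s ↦ W s ω) s = drvPath J ρ c ω s := fun s hs ↦ (hω c t hct s hs).symm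
  refine ⟨(Loewner.closedHull_eq_of_eqOn hWc (continuous_drvPath ω) hpath).symm, fun halive ↦ ?_⟩
  exact Loewner.slidHull_eq_of_eqOn hWc (continuous_drvPath ω) hpath
    fun _ hz ↦ Loewner.lt_swallowingTime_of_alive hA halive hz

end RegularPair

end SLEKappaRho

end Literature.Probability.RandomPlanarGeometry

end
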